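import Summits.ResolutionOfSingularities.ResolutionOfSingularities.Theorems.PurelyInseparableDim4JetOrder
import HarnessLib

/-!
# [OURS · res-dim4-pi] THE ORDER LETTER `o(F)` OF THE WIDE FAT POINT: `d_k = k(k+1)/2` iff the plane
  monomials of degree `< k` are independent modulo `J + 𝔪₀ᵏ`, and the DOWNWARD STAIRCASE

Cell `res-dim4-pi` (D-0157 DOOR 2), seat `res-dim4-p-3` (g2); part 2 of «the wide fat point at finite
level» (`…JetOrder.lean`).  idea-3's CARD I-3-11 / `iso6/WIDE-STRUCTURE.md` §1 defines the ORDER of the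
Hasse fat point `Z_F ≅ Spec K⟦u,v⟧ ⧸ I_F` intrinsically as `o(F) := max {k : d_k = k(k+1)/2}`,
`d_k = dim_K A ⧸ (J_q⁺(F) + 𝔪₀ᵏ)` (crit-1 V-A-27's `w27.py` computes `o` from exactly this Hilbert
function).  This file proves that the set `{k : d_k = k(k+1)/2}` is an INITIAL SEGMENT (so the `max` is
honest whenever `d` is bounded, e.g. at isolated states where `d_k ≤ μ⁺`), and identifies the equality
`d_k = k(k+1)/2` with «no non-zero `K`-combination of the `x_aⁱ x_bˡ`, `i + l < k`, lies in `J + 𝔪₀ᵏ`»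
— the finite-level reading of `I_F ⊆ (u, v)ᵏ`.  Everything is linear algebra over the frame's
`originIdeal`; no frame dynamics.

* §1 (any finite family `v` whose classes span `A ⧸ I`) `span_range_mk_eq_top`,
  `finrank_quotient_eq_card_iff_linearIndependent`, `linearIndependent_mk_iff`.
* §2 the plane monomials `x_aⁱ x_bᵈ⁻ⁱ` (`a ≠ b`) are linearly independent in `A` and graded by `d`:
  `X_pow_mul_X_pow_eq_monomial`, `sigma_exponent_injective`, `linearIndependent_sigma_pair_pow`,
  `span_range_sigma_le_span_image_lt`, `span_layers_le_span_image_ge`.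
* §3 `finrank_eq_triangle_iff` / `finrank_eq_triangle_iff_disjoint` (the ORDER test at level `k`) and
  **`finrank_eq_triangle_downward`** (the downward staircase; `jetColength_eq_triangle_downward`).

[OURS · counted 0 · elementary linear algebra; AI kernel work, weaker than expert review.]  Nothing here
is a statement about resolution of singularities; nothing here proves `NoWideTrap` / `E2(3,3)`;
resolution in dimension `≥ 4` / characteristic `p > 0` is NOT proved by anything in this file.  Host item
(DR-157-C): `stmt-ResolutionOfSingularities-16155`, helper.
-/

noncomputable section

set_option linter.dupNamespace false -- mandated namespace of this single-conjunct summit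

open MvPolynomial Finset
open scoped BigOperators

namespace Summit.ResolutionOfSingularities.ResolutionOfSingularities.Theorems.PIDim4.RidgeBudget

open IsolationCert

variable {K : Type} [Field K]

/-! ## §1 Spanning families of a quotient: `finrank = card ↔ independent` -/

/-- If the classes of `v` span `A ⧸ I` (hypothesis in the lifted form `A = span_K v + I`), then they
span `⊤` in the quotient. OURS (bookkeeping). [cite: AtiyahMacdonald1969, Prop. 6.9 (length is additive)] -/
theorem span_range_mk_eq_top {ι : Type} [Fintype ι] {I : Ideal (MvPolynomial (Fin 4) K)}
    (v : ι → MvPolynomial (Fin 4) K)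
    (h : (⊤ : Submodule K (MvPolynomial (Fin 4) K)) ≤
      Submodule.span K (Set.range v) ⊔ I.restrictScalars K) :
    Submodule.span K (Set.range fun i => Ideal.Quotient.mkₐ K I (v i)) = ⊤ := by
  refine eq_top_iff.mpr fun x _ => ?_
  obtain ⟨g, rfl⟩ := Ideal.Quotient.mkₐ_surjective K I x
  obtain ⟨s, hs, t, ht, hst⟩ := Submodule.mem_sup.mp (h (Submodule.mem_top : g ∈ ⊤))
  obtain ⟨c, rfl⟩ := (Submodule.mem_span_range_iff_exists_fun K).mp hs
  rw [Submodule.restrictScalars_mem] at ht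
  have hmk : Ideal.Quotient.mkₐ K I g = ∑ i, c i • Ideal.Quotient.mkₐ K I (v i) := by
    rw [← hst, map_add, map_sum]
    simp only [map_smul, Ideal.Quotient.mkₐ_eq_mk, Ideal.Quotient.eq_zero_iff_mem.mpr ht, add_zero]
  rw [hmk]
  exact Submodule.sum_mem _ fun i _ => Submodule.smul_mem _ _ (Submodule.subset_span ⟨i, rfl⟩)

/-- **`dim_K A ⧸ I = card ι` iff the classes of the spanning family `v` are linearly independent.**
OURS (linear algebra). [cite: AtiyahMacdonald1969, Prop. 6.9 (length is additive)] -/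
theorem finrank_quotient_eq_card_iff_linearIndependent {ι : Type} [Fintype ι]
    {I : Ideal (MvPolynomial (Fin 4) K)} (v : ι → MvPolynomial (Fin 4) K)
    (h : (⊤ : Submodule K (MvPolynomial (Fin 4) K)) ≤
      Submodule.span K (Set.range v) ⊔ I.restrictScalars K) :
    Module.finrank K (MvPolynomial (Fin 4) K ⧸ I) = Fintype.card ι ↔
      LinearIndependent K fun i => Ideal.Quotient.mkₐ K I (v i) := by
  have hspan := span_range_mk_eq_top v h
  rw [linearIndependent_iff_card_eq_finrank_span, Set.finrank, hspan, finrank_top, eq_comm]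

/-- **Independence of the classes, read in `A`**: the classes of `v` in `A ⧸ I` are linearly independent
iff no non-trivial `K`-combination of the `v i` lies in `I`. OURS (bookkeeping).
[cite: AtiyahMacdonald1969, Prop. 6.9 (length is additive)] -/
theorem linearIndependent_mk_iff {ι : Type} [Fintype ι] {I : Ideal (MvPolynomial (Fin 4) K)}
    (v : ι → MvPolynomial (Fin 4) K) :
    (LinearIndependent K fun i => Ideal.Quotient.mkₐ K I (v i)) ↔
      ∀ g : ι → K, (∑ i, g i • v i) ∈ I → ∀ i, g i = 0 := by
  rw [Fintype.linearIndependent_iff]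
  have key : ∀ g : ι → K, (∑ i, g i • Ideal.Quotient.mkₐ K I (v i)) =
      Ideal.Quotient.mkₐ K I (∑ i, g i • v i) := fun g => by
    rw [map_sum]
    simp only [map_smul]
  constructor
  · intro hli g hg
    exact hli g (by rw [key, Ideal.Quotient.mkₐ_eq_mk, Ideal.Quotient.eq_zero_iff_mem.mpr hg])
  · intro hli g hg
    refine hli g ?_
    rw [key, Ideal.Quotient.mkₐ_eq_mk] at hg
    exact Ideal.Quotient.eq_zero_iff_mem.mp hg

/-! ## §2 The plane monomials are independent in `A` and graded by degree -/

/-- `x_aⁱ x_bʲ` is the monomial with exponent `i·e_a + j·e_b`. OURS (bookkeeping). [folklore] -/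
theorem X_pow_mul_X_pow_eq_monomial (a b : Fin 4) (i j : ℕ) :
    (X a : MvPolynomial (Fin 4) K) ^ i * X b ^ j =
      monomial (Finsupp.single a i + Finsupp.single b j) 1 := by
  rw [X_pow_eq_monomial, X_pow_eq_monomial, monomial_mul, one_mul]

/-- For `a ≠ b` the exponents `i·e_a + (d−i)·e_b`, `i ≤ d < N`, are pairwise distinct. OURS (bookkeeping). [folklore] -/
theorem sigma_exponent_injective {a b : Fin 4} (hab : a ≠ b) (N : ℕ) :
    Function.Injective fun σ : (Σ d : Fin N, Fin ((d : ℕ) + 1)) =>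
      Finsupp.single a (σ.2 : ℕ) + Finsupp.single b ((σ.1 : ℕ) - (σ.2 : ℕ)) := by
  rintro ⟨d, i⟩ ⟨d', i'⟩ h
  have ha := congrArg (fun e : Fin 4 →₀ ℕ => e a) h
  have hb := congrArg (fun e : Fin 4 →₀ ℕ => e b) h
  simp only [Finsupp.coe_add, Pi.add_apply, Finsupp.single_eq_same,
    Finsupp.single_eq_of_ne hab, Finsupp.single_eq_of_ne (Ne.symm hab), add_zero, zero_add] at ha hb
  have hi : (i : ℕ) ≤ d := Nat.lt_succ_iff.mp i.is_lt
  have hi' : (i' : ℕ) ≤ d' := Nat.lt_succ_iff.mp i'.is_lt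
  have hd : (d : ℕ) = d' := by omega
  have hdd : d = d' := Fin.ext hd
  subst hdd
  have hii : i = i' := Fin.ext ha
  subst hii
  rfl

/-- **The plane monomials `x_aⁱ x_bᵈ⁻ⁱ` (`i ≤ d < N`, `a ≠ b`) are linearly independent in `A`**
(a subfamily of the monomial basis). OURS (bookkeeping; Mathlib `MvPolynomial.basisMonomials`). [folklore] -/
theorem linearIndependent_sigma_pair_pow {a b : Fin 4} (hab : a ≠ b) (N : ℕ) :
    LinearIndependent K fun σ : (Σ d : Fin N, Fin ((d : ℕ) + 1)) =>
      (X a : MvPolynomial (Fin 4) K) ^ (σ.2 : ℕ) * X b ^ ((σ.1 : ℕ) - (σ.2 : ℕ)) := by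
  have h := (MvPolynomial.basisMonomials (Fin 4) K).linearIndependent.comp _
    (sigma_exponent_injective hab N)
  have hfun : (fun σ : (Σ d : Fin N, Fin ((d : ℕ) + 1)) =>
      (X a : MvPolynomial (Fin 4) K) ^ (σ.2 : ℕ) * X b ^ ((σ.1 : ℕ) - (σ.2 : ℕ))) =
      (MvPolynomial.basisMonomials (Fin 4) K) ∘ fun σ : (Σ d : Fin N, Fin ((d : ℕ) + 1)) =>
        Finsupp.single a (σ.2 : ℕ) + Finsupp.single b ((σ.1 : ℕ) - (σ.2 : ℕ)) := by
    funext σ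
    simp only [Function.comp_apply, MvPolynomial.coe_basisMonomials]
    exact X_pow_mul_X_pow_eq_monomial a b _ _
  rw [hfun]
  exact h

/-- The degree-`< k` family spans inside the span of the basis monomials of degree `< k`. OURS (bookkeeping). [folklore] -/
theorem span_range_sigma_le_span_image_lt (a b : Fin 4) (k : ℕ) :
    Submodule.span K (Set.range fun σ : (Σ d : Fin k, Fin ((d : ℕ) + 1)) =>
        (X a : MvPolynomial (Fin 4) K) ^ (σ.2 : ℕ) * X b ^ ((σ.1 : ℕ) - (σ.2 : ℕ))) ≤
      Submodule.span K ((MvPolynomial.basisMonomials (Fin 4) K) ''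
        {e : Fin 4 →₀ ℕ | e.degree < k}) := by
  refine Submodule.span_mono ?_
  rintro _ ⟨⟨d, i⟩, rfl⟩
  refine ⟨Finsupp.single a (i : ℕ) + Finsupp.single b ((d : ℕ) - (i : ℕ)), ?_, ?_⟩
  · show (Finsupp.single a (i : ℕ) + Finsupp.single b ((d : ℕ) - (i : ℕ))).degree < k
    rw [map_add, Finsupp.degree_single, Finsupp.degree_single]
    have := Nat.lt_succ_iff.mp i.is_lt
    have := d.is_lt
    omega
  · rw [MvPolynomial.coe_basisMonomials]
    exact (X_pow_mul_X_pow_eq_monomial a b _ _).symm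

/-- The layers of degree `k' ≤ d < k` span inside the span of the basis monomials of degree `≥ k'`.
OURS (bookkeeping). [folklore] -/
theorem span_layers_le_span_image_ge (a b : Fin 4) (k' k : ℕ) :
    Submodule.span K (⋃ d ∈ Set.Ico k' k, Set.range fun i : Fin (d + 1) =>
        (X a : MvPolynomial (Fin 4) K) ^ (i : ℕ) * X b ^ (d - (i : ℕ))) ≤
      Submodule.span K ((MvPolynomial.basisMonomials (Fin 4) K) ''
        {e : Fin 4 →₀ ℕ | k' ≤ e.degree}) := by
  refine Submodule.span_mono ?_
  intro x hx
  simp only [Set.mem_iUnion, Set.mem_Ico, Set.mem_range, exists_prop] at hx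
  obtain ⟨d, ⟨hd, -⟩, i, rfl⟩ := hx
  refine ⟨Finsupp.single a (i : ℕ) + Finsupp.single b (d - (i : ℕ)), ?_, ?_⟩
  · show k' ≤ (Finsupp.single a (i : ℕ) + Finsupp.single b (d - (i : ℕ))).degree
    rw [map_add, Finsupp.degree_single, Finsupp.degree_single]
    have := Nat.lt_succ_iff.mp i.is_lt
    omega
  · rw [MvPolynomial.coe_basisMonomials]
    exact (X_pow_mul_X_pow_eq_monomial a b _ _).symm

/-- Combinations of monomials of degree `< k'` and of degree `≥ k'` meet only in `0`. OURS (bookkeeping;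
`LinearIndependent.disjoint_span_image` for the monomial basis). [folklore] -/
theorem disjoint_span_lt_span_layers (a b : Fin 4) (k' k : ℕ) :
    Disjoint
      (Submodule.span K (Set.range fun σ : (Σ d : Fin k', Fin ((d : ℕ) + 1)) =>
        (X a : MvPolynomial (Fin 4) K) ^ (σ.2 : ℕ) * X b ^ ((σ.1 : ℕ) - (σ.2 : ℕ))))
      (Submodule.span K (⋃ d ∈ Set.Ico k' k, Set.range fun i : Fin (d + 1) =>
        (X a : MvPolynomial (Fin 4) K) ^ (i : ℕ) * X b ^ (d - (i : ℕ)))) := by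
  refine Disjoint.mono (span_range_sigma_le_span_image_lt a b k')
    (span_layers_le_span_image_ge a b k' k) ?_
  refine (MvPolynomial.basisMonomials (Fin 4) K).linearIndependent.disjoint_span_image ?_
  exact Set.disjoint_left.mpr fun e (he : e.degree < k') (he' : k' ≤ e.degree) => by omega

/-! ## §3 The ORDER test at level `k` and the downward staircase -/

/-- **ORDER TEST.** Under `𝔪₀ ≤ (x_a, x_b) + J + 𝔪₀²`: `dim_K A ⧸ (J + 𝔪₀ᵏ) = k(k+1)/2` iff no
non-trivial `K`-combination of the `x_aⁱ x_bˡ`, `i + l < k`, lies in `J + 𝔪₀ᵏ` (finite-level form of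
`I_F ⊆ (u,v)ᵏ`, i.e. `k ≤ o(F)`). OURS (linear algebra). [cite: AtiyahMacdonald1969, Prop. 6.9 (length is additive)] -/
theorem finrank_eq_triangle_iff {J : Ideal (MvPolynomial (Fin 4) K)} {a b : Fin 4}
    (hm : originIdeal K ≤ Ideal.span {(X a : MvPolynomial (Fin 4) K), X b} ⊔ J ⊔ originIdeal K ^ 2)
    (k : ℕ) :
    Module.finrank K (MvPolynomial (Fin 4) K ⧸ (J ⊔ originIdeal K ^ k)) = k * (k + 1) / 2 ↔
      ∀ g : (Σ d : Fin k, Fin ((d : ℕ) + 1)) → K,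
        (∑ σ, g σ • ((X a : MvPolynomial (Fin 4) K) ^ (σ.2 : ℕ) * X b ^ ((σ.1 : ℕ) - (σ.2 : ℕ)))) ∈
          J ⊔ originIdeal K ^ k → ∀ σ, g σ = 0 := by
  have hsp : (⊤ : Submodule K (MvPolynomial (Fin 4) K)) ≤
      Submodule.span K (Set.range fun σ : (Σ d : Fin k, Fin ((d : ℕ) + 1)) =>
        (X a : MvPolynomial (Fin 4) K) ^ (σ.2 : ℕ) * X b ^ ((σ.1 : ℕ) - (σ.2 : ℕ))) ⊔
        (J ⊔ originIdeal K ^ k).restrictScalars K := by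
    rw [range_sigma_pair_pow_eq]; exact top_le_span_pair_layers_sup hm k
  rw [← sum_range_succ_eq_triangle, ← card_sigma_fin_succ,
    finrank_quotient_eq_card_iff_linearIndependent _ hsp, linearIndependent_mk_iff]

/-- **ORDER TEST, subspace form** (uses `a ≠ b`: the plane monomials are independent in `A`):
`d_k = k(k+1)/2` iff the `K`-span of the `x_aⁱ x_bˡ`, `i + l < k`, meets `J + 𝔪₀ᵏ` only in `0`.
OURS (linear algebra). [cite: AtiyahMacdonald1969, Prop. 6.9 (length is additive)] -/
theorem finrank_eq_triangle_iff_disjoint {J : Ideal (MvPolynomial (Fin 4) K)} {a b : Fin 4}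
    (hab : a ≠ b)
    (hm : originIdeal K ≤ Ideal.span {(X a : MvPolynomial (Fin 4) K), X b} ⊔ J ⊔ originIdeal K ^ 2)
    (k : ℕ) :
    Module.finrank K (MvPolynomial (Fin 4) K ⧸ (J ⊔ originIdeal K ^ k)) = k * (k + 1) / 2 ↔
      Disjoint
        (Submodule.span K (Set.range fun σ : (Σ d : Fin k, Fin ((d : ℕ) + 1)) =>
          (X a : MvPolynomial (Fin 4) K) ^ (σ.2 : ℕ) * X b ^ ((σ.1 : ℕ) - (σ.2 : ℕ))))
        ((J ⊔ originIdeal K ^ k).restrictScalars K) := by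
  rw [finrank_eq_triangle_iff hm k, Submodule.disjoint_def]
  constructor
  · intro h x hx hxI
    obtain ⟨g, rfl⟩ := (Submodule.mem_span_range_iff_exists_fun K).mp hx
    rw [Submodule.restrictScalars_mem] at hxI
    have hg := h g hxI
    exact Finset.sum_eq_zero fun σ _ => by rw [hg σ, zero_smul]
  · intro h g hg σ
    have hx : (∑ σ, g σ • ((X a : MvPolynomial (Fin 4) K) ^ (σ.2 : ℕ) * X b ^ ((σ.1 : ℕ) - (σ.2 : ℕ)))) ∈
        Submodule.span K (Set.range fun σ : (Σ d : Fin k, Fin ((d : ℕ) + 1)) =>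
          (X a : MvPolynomial (Fin 4) K) ^ (σ.2 : ℕ) * X b ^ ((σ.1 : ℕ) - (σ.2 : ℕ))) :=
      Submodule.sum_mem _ fun σ _ => Submodule.smul_mem _ _ (Submodule.subset_span ⟨σ, rfl⟩)
    have h0 := h _ hx ((Submodule.restrictScalars_mem K _ _).mpr hg)
    exact Fintype.linearIndependent_iff.mp (linearIndependent_sigma_pair_pow hab k) g h0 σ

/-- **THE DOWNWARD STAIRCASE.** Under `𝔪₀ ≤ (x_a, x_b) + J + 𝔪₀²` (`a ≠ b`): if `d_k = k(k+1)/2` then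
`d_{k'} = k'(k'+1)/2` for every `k' ≤ k` — the set `{k : d_k = k(k+1)/2}` is an initial segment, so
idea-3's `o(F) := max {k : d_k = k(k+1)/2}` is well defined whenever `d` is bounded (isolated states).
Proof: a degree-`< k'` combination `x` in `J + 𝔪₀^{k'}` is, modulo the layers of degree `k' ≤ d < k`
(`originIdeal_pow_le_span_layers_sup`), a degree-`< k` combination in `J + 𝔪₀ᵏ`, hence `0` at level `k`;
then `x` equals a combination of monomials of degree `≥ k'`, so `x = 0` by the grading. OURS (linear algebra).
[cite: AtiyahMacdonald1969, Prop. 6.9 (length is additive)] -/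
theorem finrank_eq_triangle_downward {J : Ideal (MvPolynomial (Fin 4) K)} {a b : Fin 4} (hab : a ≠ b)
    (hm : originIdeal K ≤ Ideal.span {(X a : MvPolynomial (Fin 4) K), X b} ⊔ J ⊔ originIdeal K ^ 2)
    {k k' : ℕ}
    (hk : Module.finrank K (MvPolynomial (Fin 4) K ⧸ (J ⊔ originIdeal K ^ k)) = k * (k + 1) / 2)
    (hk' : k' ≤ k) :
    Module.finrank K (MvPolynomial (Fin 4) K ⧸ (J ⊔ originIdeal K ^ k')) = k' * (k' + 1) / 2 := by
  rw [finrank_eq_triangle_iff_disjoint hab hm] at hk ⊢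
  rw [Submodule.disjoint_def] at hk ⊢
  intro x hx hxI
  rw [Submodule.restrictScalars_mem] at hxI
  obtain ⟨j, hj, m, hm0, rfl⟩ := Submodule.mem_sup.mp hxI
  -- resolve `m ∈ 𝔪₀^{k'}` through the layers `k' ≤ d < k`
  obtain ⟨s, hs, t, ht, rfl⟩ := Submodule.mem_sup.mp
    (originIdeal_pow_le_span_layers_sup hm hk' ((Submodule.restrictScalars_mem K _ _).mpr hm0))
  rw [Submodule.restrictScalars_mem] at ht
  -- `(j + (s + t)) - s = j + t ∈ J + 𝔪₀ᵏ` is a degree-`< k` combination, hence `0`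
  have hlow : j + (s + t) - s ∈ Submodule.span K (Set.range fun σ : (Σ d : Fin k, Fin ((d : ℕ) + 1)) =>
      (X a : MvPolynomial (Fin 4) K) ^ (σ.2 : ℕ) * X b ^ ((σ.1 : ℕ) - (σ.2 : ℕ))) := by
    refine Submodule.sub_mem _ ?_ ?_
    · refine Submodule.span_mono ?_ hx
      rw [range_sigma_pair_pow_eq, range_sigma_pair_pow_eq]
      exact Set.biUnion_subset_biUnion_left fun d hd => ⟨hd.1, lt_of_lt_of_le hd.2 hk'⟩
    · refine Submodule.span_mono ?_ hs
      rw [range_sigma_pair_pow_eq]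
      exact Set.biUnion_subset_biUnion_left fun d hd => ⟨Nat.zero_le d, hd.2⟩
  have hzero : j + (s + t) - s = 0 := by
    refine hk _ hlow ?_
    rw [Submodule.restrictScalars_mem, show j + (s + t) - s = j + t by ring]
    exact Submodule.add_mem _ (Submodule.mem_sup_left hj) ht
  -- so `x = s`: a degree-`< k'` combination equal to a combination of degrees `≥ k'`
  have hxs : j + (s + t) = s := sub_eq_zero.mp hzero
  have hdis := disjoint_span_lt_span_layers (K := K) a b k' k
  rw [Submodule.disjoint_def] at hdis
  exact hdis _ hx (by rw [hxs]; exact hs)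

/-- **Downward staircase in `μ⁺`-vocabulary**: with `J = J_q⁺(F)` the levels `k` with
`jetColength q k F = k(k+1)/2` form an initial segment (`o(F)` well defined at isolated states, where
`jetColength q k F ≤ μ⁺ < k(k+1)/2` for large `k`). OURS (linear algebra).
[cite: AtiyahMacdonald1969, Prop. 6.9 (length is additive)] -/
theorem jetColength_eq_triangle_downward {q : ℕ} {F : MvPolynomial (Fin 4) K} {a b : Fin 4}
    (hab : a ≠ b)
    (hm : originIdeal K ≤ Ideal.span {(X a : MvPolynomial (Fin 4) K), X b} ⊔ singLocusIdeal q F ⊔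
      originIdeal K ^ 2)
    {k k' : ℕ} (hk : jetColength q k F = k * (k + 1) / 2) (hk' : k' ≤ k) :
    jetColength q k' F = k' * (k' + 1) / 2 :=
  finrank_eq_triangle_downward hab hm hk hk'

/-! ## §4 (APPEND) A low-degree power of a residual coordinate is a plane relation: the ORDER drops -/

/-- **`x_aᵐ ∈ J + 𝔪₀ᵏ` with `m < k` forces `d_k ≠ k(k+1)/2`** (`x_aᵐ` is one of the plane monomials of
degree `< k`, so it is a non-trivial plane relation modulo `J + 𝔪₀ᵏ`).  With `J = J_p⁺(F′)`, `a = j` the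
chart coordinate of a non-tangent edge and `m = o(F) − 1` (I-3-11 (NT): `x_j^{o−1} ∈ Ĵ⁺(F′)`), this is
the kernel of «`o(F′) ≤ o(F) − 1`». OURS (linear algebra). [cite: AtiyahMacdonald1969, Prop. 6.9 (length is additive)] -/
theorem finrank_ne_triangle_of_X_pow_mem {J : Ideal (MvPolynomial (Fin 4) K)} {a b : Fin 4}
    (hab : a ≠ b)
    (hm : originIdeal K ≤ Ideal.span {(X a : MvPolynomial (Fin 4) K), X b} ⊔ J ⊔ originIdeal K ^ 2)
    {m k : ℕ} (hmk : m < k) (hx : (X a : MvPolynomial (Fin 4) K) ^ m ∈ J ⊔ originIdeal K ^ k) :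
    Module.finrank K (MvPolynomial (Fin 4) K ⧸ (J ⊔ originIdeal K ^ k)) ≠ k * (k + 1) / 2 := by
  rw [Ne, finrank_eq_triangle_iff_disjoint hab hm k, Submodule.disjoint_def]
  intro h
  have hmem : (X a : MvPolynomial (Fin 4) K) ^ m ∈
      Submodule.span K (Set.range fun σ : (Σ d : Fin k, Fin ((d : ℕ) + 1)) =>
        (X a : MvPolynomial (Fin 4) K) ^ (σ.2 : ℕ) * X b ^ ((σ.1 : ℕ) - (σ.2 : ℕ))) :=
    Submodule.subset_span ⟨⟨⟨m, hmk⟩, ⟨m, Nat.lt_succ_self m⟩⟩, by simp⟩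
  exact pow_ne_zero m (X_ne_zero a) (h _ hmem ((Submodule.restrictScalars_mem K _ _).mpr hx))

/-- The same for the second residual coordinate: `x_bᵐ ∈ J + 𝔪₀ᵏ`, `m < k` ⇒ `d_k ≠ k(k+1)/2`.
OURS (linear algebra). [cite: AtiyahMacdonald1969, Prop. 6.9 (length is additive)] -/
theorem finrank_ne_triangle_of_X_pow_mem' {J : Ideal (MvPolynomial (Fin 4) K)} {a b : Fin 4}
    (hab : a ≠ b)
    (hm : originIdeal K ≤ Ideal.span {(X a : MvPolynomial (Fin 4) K), X b} ⊔ J ⊔ originIdeal K ^ 2)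
    {m k : ℕ} (hmk : m < k) (hx : (X b : MvPolynomial (Fin 4) K) ^ m ∈ J ⊔ originIdeal K ^ k) :
    Module.finrank K (MvPolynomial (Fin 4) K ⧸ (J ⊔ originIdeal K ^ k)) ≠ k * (k + 1) / 2 := by
  rw [Ne, finrank_eq_triangle_iff_disjoint hab hm k, Submodule.disjoint_def]
  intro h
  have hmem : (X b : MvPolynomial (Fin 4) K) ^ m ∈
      Submodule.span K (Set.range fun σ : (Σ d : Fin k, Fin ((d : ℕ) + 1)) =>
        (X a : MvPolynomial (Fin 4) K) ^ (σ.2 : ℕ) * X b ^ ((σ.1 : ℕ) - (σ.2 : ℕ))) :=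
    Submodule.subset_span ⟨⟨⟨m, hmk⟩, ⟨0, Nat.succ_pos m⟩⟩, by simp⟩
  exact pow_ne_zero m (X_ne_zero b) (h _ hmem ((Submodule.restrictScalars_mem K _ _).mpr hx))

/-- **ORDER DROP, staircase form**: a residual-coordinate power `x_aᵐ ∈ J + 𝔪₀^{k₀}` with `m < k₀`
excludes EVERY level `k ≥ k₀` from `{k : d_k = k(k+1)/2}` (downward staircase), i.e. `o(J) ≤ k₀ − 1`;
with the plane bound, `d_k < k(k+1)/2` for all `k ≥ k₀`. OURS (linear algebra).
[cite: AtiyahMacdonald1969, Prop. 6.9 (length is additive)] -/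
theorem finrank_lt_triangle_of_X_pow_mem {J : Ideal (MvPolynomial (Fin 4) K)} {a b : Fin 4}
    (hab : a ≠ b)
    (hm : originIdeal K ≤ Ideal.span {(X a : MvPolynomial (Fin 4) K), X b} ⊔ J ⊔ originIdeal K ^ 2)
    {m k₀ : ℕ} (hmk : m < k₀) (hx : (X a : MvPolynomial (Fin 4) K) ^ m ∈ J ⊔ originIdeal K ^ k₀)
    {k : ℕ} (hk : k₀ ≤ k) :
    Module.finrank K (MvPolynomial (Fin 4) K ⧸ (J ⊔ originIdeal K ^ k)) < k * (k + 1) / 2 := by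
  refine lt_of_le_of_ne (finrank_quotient_le_triangle hm k) fun h => ?_
  exact finrank_ne_triangle_of_X_pow_mem hab hm hmk hx (finrank_eq_triangle_downward hab hm h hk)

/-- `μ⁺`-vocabulary: `x_aᵐ ∈ J_q⁺(F) + 𝔪₀^{k₀}`, `m < k₀ ≤ k` ⇒ `jetColength q k F < k(k+1)/2`.
OURS (linear algebra). [cite: AtiyahMacdonald1969, Prop. 6.9 (length is additive)] -/
theorem jetColength_lt_triangle_of_X_pow_mem {q : ℕ} {F : MvPolynomial (Fin 4) K} {a b : Fin 4}
    (hab : a ≠ b)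
    (hm : originIdeal K ≤ Ideal.span {(X a : MvPolynomial (Fin 4) K), X b} ⊔ singLocusIdeal q F ⊔
      originIdeal K ^ 2)
    {m k₀ : ℕ} (hmk : m < k₀)
    (hx : (X a : MvPolynomial (Fin 4) K) ^ m ∈ singLocusIdeal q F ⊔ originIdeal K ^ k₀)
    {k : ℕ} (hk : k₀ ≤ k) :
    jetColength q k F < k * (k + 1) / 2 :=
  finrank_lt_triangle_of_X_pow_mem hab hm hmk hx hk

end Summit.ResolutionOfSingularities.ResolutionOfSingularities.Theorems.PIDim4.RidgeBudget

end
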